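import Summits.NavierStokesRegularity.FluidComputer.PalasekTowerGermHostDipoleCone
import Literature.Analysis.FluidPDE.WholeSpaceIBP

/-!
# The germ host, IX: two integrations by parts — the far-field pressure number as a POINTWISE-SIGNED integral

Cell `ns-blowup`, seat `ns-blowup-ecbridge-3` (g3); GROUP C «BRIDGE SUPPORT» of the route
`PalasekTowerBreakdown` (crux `EpisodeBaseG`, item stmt-NavierStokesRegularity-19179, R2 of record).
LABEL: E–C typing (KERNEL calculus: one auxiliary definition — the smooth far copy of the dipole
kernel — and identities). WHAT THIS IS NOT: not Navier–Stokes evidence — integral identities for the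
pressure gradient of a PRESCRIBED compactly supported profile; no profile is claimed to pass the test.

## What and why

`PalasekTowerGermHostFarField.anchor_test_iff_integral` (p448542): for a symmetric composite design
`U = U₁ + U₂` the strict anchor test at `x₀` reads `−ν⟪U₁,ΔU₁⟫(x₀) < ∫ ∂ₑΓ(x₀ − x)·div((U₂·∇)U₂) dx`,
`e = U₁(x₀)`. Here the right-hand side is integrated by parts twice (the tree's whole-space identities
`integral_mul_divergence_add_eq_zero_right` and `integral_inner_convect_add_eq_zero`, with
`div U₂ = 0`), against the SMOOTH far copy `x ↦ ∂ₑΓ∞(x₀ − x)` of the dipole kernel (`newtonFar`,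
equal to `Γ` beyond radius `r` — legitimate because `x₀` is at distance `> r` from `tsupport U₂`):

* §1 `integral_mul_divergence_convect_eq`: `∫ K · div((U·∇)U) = ∫ D²K(x)[U(x), U(x)] dx` for any
  `K ∈ C²` and `U ∈ C_c^∞` divergence free;
* §2 the far dipole kernel `dipoleFar x₀ e r` and its second derivative `= D³Γ(x₀ − x)(e, v, v)`
  beyond radius `r` (`fderiv3_newtonKernel_apply`, p449691);
* §3 **`inner_gradient_pot_eq_neg_integral_fderiv3`**:
  `⟪∇π[U₂](x₀), e⟫ = −∫ D³Γ(x₀ − x)(U₂ x, U₂ x, e) dx` when `dist(x₀, tsupport U₂) > r > 0`, and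
  **`anchor_test_iff_fderiv3`**: the strict test of the composite ⟺
  `−ν⟪U₁(x₀), ΔU₁(x₀)⟫ < ∫ D³Γ(x₀ − x)(U₂ x, U₂ x, U₁ x₀) dx`, whose integrand is POINTWISE POSITIVE for
  far structures with velocities `⊥ U₁(x₀)` placed in the forward cone
  (`fderiv3_newtonKernel_dde_pos`) — the last structural piece before a kernel instance of
  `LevelZeroData` (which still owes the two explicit fields and a quantitative lower bound).

References: D. Gilbarg, N. S. Trudinger, *Elliptic PDE of Second Order* (2001), (2.13), Lemma 4.1
[cite: GilbargTrudinger2001, (2.13)]; J. Leray, Acta Math. 63 (1934), §6 (1.11) (integration by parts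
on the whole space) [cite: Leray1934, §6 (1.11) p. 203].
-/

noncomputable section

namespace Summit.NavierStokesRegularity.FluidComputer.PalasekTowerClayBridge.Germ

open Set Function Filter Topology InnerProductSpace MeasureTheory Real
open scoped Topology ContDiff RealInnerProductSpace Laplacian

open Literature.Analysis.FluidPDE

-- nested operator types `ℝ³ →L[ℝ] ℝ³ →L[ℝ] ℝ` (second derivatives)
set_option maxSynthPendingDepth 3

/-! ## §1 Two integrations by parts against a `C²` weight -/

/-- The self-convection of a compactly supported field is compactly supported. [folklore] -/
theorem hasCompactSupport_convect_self {U : EuclideanSpace ℝ (Fin 3) → EuclideanSpace ℝ (Fin 3)}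
    (hUc : HasCompactSupport U) : HasCompactSupport (convect U U) :=
  hUc.mono' fun z hz => by
    apply subset_tsupport
    rw [mem_support] at hz ⊢
    intro hUz
    exact hz (by rw [convect_apply, hUz, map_zero])

/-- The gradient of a `C²` function is `C¹`. [folklore] -/
theorem contDiff_one_gradient {K : EuclideanSpace ℝ (Fin 3) → ℝ} (hK : ContDiff ℝ 2 K) :
    ContDiff ℝ 1 (gradient K) := by
  have h : ContDiff ℝ 1 (fderiv ℝ K) := hK.fderiv_right (m := 1) le_rfl
  exact (InnerProductSpace.toDual ℝ (EuclideanSpace ℝ (Fin 3))).symm.contDiff.comp h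

/-- `⟪(U·∇)∇K (x), U x⟫ = D²K(x)[U x, U x]`. [folklore] -/
theorem inner_convect_gradient_eq {K : EuclideanSpace ℝ (Fin 3) → ℝ} (hK : ContDiff ℝ 2 K)
    (U : EuclideanSpace ℝ (Fin 3) → EuclideanSpace ℝ (Fin 3)) (x : EuclideanSpace ℝ (Fin 3)) :
    ⟪convect U (gradient K) x, U x⟫ = fderiv ℝ (fun y => fderiv ℝ K y (U x)) x (U x) := by
  have hD : DifferentiableAt ℝ (fderiv ℝ K) x :=
    ((hK.fderiv_right (m := 1) le_rfl).differentiable one_ne_zero) x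
  rw [convect_apply, (hasFDerivAt_gradient hK x).fderiv, ContinuousLinearMap.coe_comp,
    comp_apply, fderiv_apply_const_apply hD]
  exact InnerProductSpace.toDual_symm_apply

/-- **Two integrations by parts**: for `K ∈ C²` and `U ∈ C_c^∞` divergence free,
`∫ K · div((U·∇)U) = ∫ D²K(x)[U(x), U(x)] dx` (`∫ K div c = −∫ ⟪c, ∇K⟫` with `c = (U·∇)U`
compactly supported; `∫ ⟪∇K, (U·∇)U⟫ = −∫ ⟪(U·∇)∇K, U⟫` since `div U = 0`). [cite: Leray1934, §6 (1.11) p. 203] -/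
theorem integral_mul_divergence_convect_eq {K : EuclideanSpace ℝ (Fin 3) → ℝ} (hK : ContDiff ℝ 2 K)
    {U : EuclideanSpace ℝ (Fin 3) → EuclideanSpace ℝ (Fin 3)} (hU : ContDiff ℝ ∞ U)
    (hUc : HasCompactSupport U) (hdiv : VectorCalculus.IsDivFree U) :
    ∫ x, K x * VectorCalculus.divergence (convect U U) x =
      ∫ x, fderiv ℝ (fun y => fderiv ℝ K y (U x)) x (U x) := by
  have hK1 : ContDiff ℝ 1 K := hK.of_le (by norm_num)
  have hU1 : ContDiff ℝ 1 U := hU.of_le (by norm_cast)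
  have hc1 : ContDiff ℝ 1 (convect U U) := (contDiff_convect_self hU).of_le (by norm_cast)
  have h1 := integral_mul_divergence_add_eq_zero_right hK1 hc1 (hasCompactSupport_convect_self hUc)
  have h2 := integral_inner_convect_add_eq_zero hU1 (contDiff_one_gradient hK) hU1 hUc
  have h3 : ∫ x, VectorCalculus.divergence U x * ⟪gradient K x, U x⟫ = 0 := by
    rw [integral_congr_ae (Eventually.of_forall fun x => ?_)]
    · exact integral_zero _ _
    · simp only [hdiv x, zero_mul]
  have h4 : ∫ x, ⟪convect U U x, gradient K x⟫ = ∫ x, ⟪gradient K x, convect U U x⟫ :=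
    integral_congr_ae (Eventually.of_forall fun x => real_inner_comm _ _)
  have h5 : ∫ x, ⟪convect U (gradient K) x, U x⟫ =
      ∫ x, fderiv ℝ (fun y => fderiv ℝ K y (U x)) x (U x) :=
    integral_congr_ae (Eventually.of_forall fun x => inner_convect_gradient_eq hK U x)
  linarith

/-! ## §2 The smooth far copy of the dipole kernel -/

/-- **The far dipole kernel** `x ↦ ∂ₑΓ∞(x₀ − x)`, `Γ∞ = newtonFar (r/2) r` (smooth, `= Γ` beyond
radius `r`). [folklore] -/
def dipoleFar (x₀ e : EuclideanSpace ℝ (Fin 3)) (r : ℝ) (x : EuclideanSpace ℝ (Fin 3)) : ℝ :=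
  fderiv ℝ (newtonFar (r / 2) r) (x₀ - x) e

section DipoleFar

variable {x₀ e : EuclideanSpace ℝ (Fin 3)} {r : ℝ} (hr : 0 < r)
include hr

/-- The far dipole kernel is smooth. [folklore] -/
theorem contDiff_dipoleFar (n : ℕ) : ContDiff ℝ n (dipoleFar x₀ e r) := by
  have hF : ContDiff ℝ (n + 1 : ℕ) (newtonFar (r / 2) r) := contDiff_newtonFar' hr (n + 1)
  have hD : ContDiff ℝ n (fderiv ℝ (newtonFar (r / 2) r)) :=
    hF.fderiv_right (m := n) (by push_cast; exact le_rfl)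
  have hA : ContDiff ℝ n (fun x : EuclideanSpace ℝ (Fin 3) => x₀ - x) := contDiff_const.sub contDiff_id
  exact (hD.comp hA).clm_apply contDiff_const

/-- Beyond radius `r` the smooth far copy agrees with `Γ` near `x₀ − x`, so every nested derivative
agrees there. [folklore] -/
theorem newtonFar_eventuallyEq {x : EuclideanSpace ℝ (Fin 3)} (hx : r < ‖x₀ - x‖) :
    newtonFar (r / 2) r =ᶠ[𝓝 (x₀ - x)] newtonKernel :=
  newtonFar_eventuallyEq_newtonKernel (by linarith) (by linarith) hx

/-- First derivatives of `Γ∞` and `Γ` agree on the open exterior `{r < ‖z‖}`, as functions near any of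
its points. [folklore] -/
theorem fderiv_newtonFar_eventuallyEq {z : EuclideanSpace ℝ (Fin 3)} (hz : r < ‖z‖)
    (a : EuclideanSpace ℝ (Fin 3)) :
    (fun w => fderiv ℝ (newtonFar (r / 2) r) w a) =ᶠ[𝓝 z] fun w => fderiv ℝ newtonKernel w a := by
  have hopen : IsOpen {w : EuclideanSpace ℝ (Fin 3) | r < ‖w‖} := isOpen_lt continuous_const continuous_norm
  filter_upwards [hopen.mem_nhds hz] with w hw
  rw [(newtonFar_eventuallyEq_newtonKernel (by linarith) (by linarith) hw).fderiv_eq]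

/-- … and so do the second derivatives. [folklore] -/
theorem fderiv_fderiv_newtonFar_eventuallyEq {z : EuclideanSpace ℝ (Fin 3)} (hz : r < ‖z‖)
    (a b : EuclideanSpace ℝ (Fin 3)) :
    (fun w => fderiv ℝ (fun w' => fderiv ℝ (newtonFar (r / 2) r) w' a) w b) =ᶠ[𝓝 z]
      fun w => fderiv ℝ (fun w' => fderiv ℝ newtonKernel w' a) w b := by
  have hopen : IsOpen {w : EuclideanSpace ℝ (Fin 3) | r < ‖w‖} := isOpen_lt continuous_const continuous_norm
  filter_upwards [hopen.mem_nhds hz] with w hw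
  rw [(fderiv_newtonFar_eventuallyEq hr hw a).fderiv_eq]

/-- Beyond radius `r` the far dipole kernel IS `∂ₑΓ(x₀ − x)`. [folklore] -/
theorem dipoleFar_eq {x : EuclideanSpace ℝ (Fin 3)} (hx : r < ‖x₀ - x‖) :
    dipoleFar x₀ e r x = fderiv ℝ newtonKernel (x₀ - x) e := by
  rw [dipoleFar, (newtonFar_eventuallyEq hr hx).fderiv_eq]

/-- **The second derivative of the far dipole kernel beyond radius `r` is the third derivative of
`Γ`**: `D²(dipoleFar)(x)[v, v] = D³Γ(x₀ − x)(e, v, v)` (chain rule through `x ↦ x₀ − x`, two sign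
flips). [cite: GilbargTrudinger2001, (2.13)] -/
theorem fderiv_fderiv_dipoleFar_eq {x : EuclideanSpace ℝ (Fin 3)} (hx : r < ‖x₀ - x‖)
    (v : EuclideanSpace ℝ (Fin 3)) :
    fderiv ℝ (fun y => fderiv ℝ (dipoleFar x₀ e r) y v) x v =
      fderiv ℝ (fun w => fderiv ℝ (fun w' => fderiv ℝ newtonKernel w' e) w v) (x₀ - x) v := by
  -- `g z := ∂ₑΓ∞(z)`, smooth; `dipoleFar = g ∘ A`, `A x = x₀ − x`
  set g : EuclideanSpace ℝ (Fin 3) → ℝ := fun z => fderiv ℝ (newtonFar (r / 2) r) z e with hg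
  have hF : ContDiff ℝ 3 (newtonFar (r / 2) r) := contDiff_newtonFar' hr 3
  have hgs : ContDiff ℝ 2 g := (hF.fderiv_right (m := 2) (by norm_cast)).clm_apply contDiff_const
  have hgd : Differentiable ℝ g := hgs.differentiable (by norm_num)
  have hg1d : Differentiable ℝ (fun z => fderiv ℝ g z v) :=
    ((hgs.fderiv_right (m := 1) (by norm_cast)).clm_apply contDiff_const).differentiable one_ne_zero
  have hA : ∀ y : EuclideanSpace ℝ (Fin 3), HasFDerivAt (fun x : EuclideanSpace ℝ (Fin 3) => x₀ - x)
      (-(ContinuousLinearMap.id ℝ (EuclideanSpace ℝ (Fin 3)))) y := fun y => by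
    have h := (hasFDerivAt_const (𝕜 := ℝ) x₀ y).sub (hasFDerivAt_id (𝕜 := ℝ) y)
    rw [zero_sub] at h; exact h
  -- first derivative of the composite along `v`
  have h1 : (fun y => fderiv ℝ (dipoleFar x₀ e r) y v) = fun y => -(fderiv ℝ g (x₀ - y) v) := by
    funext y
    have hc := ((hgd (x₀ - y)).hasFDerivAt.comp y (hA y)).fderiv
    have e1 : dipoleFar x₀ e r = g ∘ fun x => x₀ - x := rfl
    rw [e1, hc]
    simp
  rw [h1, fderiv_fun_neg]
  have hc2 := ((hg1d (x₀ - x)).hasFDerivAt.comp x (hA x)).fderiv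
  have e2 : (fun y => fderiv ℝ g (x₀ - y) v) = (fun z => fderiv ℝ g z v) ∘ fun x => x₀ - x := rfl
  rw [e2, hc2]
  simp only [neg_apply, ContinuousLinearMap.coe_comp, comp_apply,
    ContinuousLinearMap.coe_id', id_eq, map_neg, neg_neg]
  -- replace `Γ∞` by `Γ` in the nested derivatives at `x₀ − x`
  simp only [hg]
  rw [(fderiv_fderiv_newtonFar_eventuallyEq hr hx e v).fderiv_eq]

end DipoleFar

/-! ## §3 The far-field pressure number as an integral of `D³Γ` -/

/-- The nesting order of the third derivative does not matter off the origin (the closed form of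
`fderiv3_newtonKernel_apply` is symmetric); in particular `D³Γ(z)(e, d, d) = D³Γ(z)(d, d, e)`.
[cite: GilbargTrudinger2001, (2.13)] -/
theorem fderiv3_newtonKernel_edd_eq_dde {z : EuclideanSpace ℝ (Fin 3)} (hz : z ≠ 0)
    (d e : EuclideanSpace ℝ (Fin 3)) :
    fderiv ℝ (fun w => fderiv ℝ (fun w' => fderiv ℝ newtonKernel w' e) w d) z d =
      fderiv ℝ (fun w => fderiv ℝ (fun w' => fderiv ℝ newtonKernel w' d) w d) z e := by
  rw [fderiv3_newtonKernel_apply hz, fderiv3_newtonKernel_apply hz, real_inner_comm d e]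
  ring

/-- **`⟪∇π[U](x₀), e⟫ = −∫ D³Γ(x₀ − x)(U x, U x, e) dx`** for a divergence-free test profile whose
support stays at distance `> r > 0` from `x₀`. [cite: GilbargTrudinger2001, Lemma 4.1] -/
theorem inner_gradient_pot_eq_neg_integral_fderiv3 {ν : ℝ}
    {U : EuclideanSpace ℝ (Fin 3) → EuclideanSpace ℝ (Fin 3)} (hU : ContDiff ℝ ∞ U)
    (hUc : HasCompactSupport U) (hdiv : VectorCalculus.IsDivFree U) {x₀ : EuclideanSpace ℝ (Fin 3)}
    {r : ℝ} (hr : 0 < r) (hfar : ∀ x ∈ tsupport U, r < ‖x₀ - x‖) (e : EuclideanSpace ℝ (Fin 3)) :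
    ⟪gradient (pot ν U) x₀, e⟫ =
      -∫ x, fderiv ℝ (fun w => fderiv ℝ (fun w' => fderiv ℝ newtonKernel w' (U x)) w (U x))
        (x₀ - x) e := by
  have hx₀ : x₀ ∉ tsupport U := fun h => by
    have := hfar x₀ h
    rw [sub_self, norm_zero] at this
    exact absurd this (not_lt.2 hr.le)
  rw [inner_gradient_pot_eq_neg_integral hU hUc hdiv ν x₀ e]
  congr 1
  -- pass to the smooth far kernel, integrate by parts twice, and come back
  have step1 : ∫ x, fderiv ℝ newtonKernel (x₀ - x) e * VectorCalculus.divergence (convect U U) x =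
      ∫ x, dipoleFar x₀ e r x * VectorCalculus.divergence (convect U U) x := by
    refine integral_congr_ae (Eventually.of_forall fun x => ?_)
    by_cases hx : x ∈ tsupport U
    · simp only [dipoleFar_eq hr (hfar x hx)]
    · simp only [divergence_convect_eq_zero_of_notMem_tsupport hx, mul_zero]
  have step2 := integral_mul_divergence_convect_eq
    (by exact_mod_cast contDiff_dipoleFar (x₀ := x₀) (e := e) hr 2) hU hUc hdiv
  have step3 : ∫ x, fderiv ℝ (fun y => fderiv ℝ (dipoleFar x₀ e r) y (U x)) x (U x) =
      ∫ x, fderiv ℝ (fun w => fderiv ℝ (fun w' => fderiv ℝ newtonKernel w' (U x)) w (U x))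
        (x₀ - x) e := by
    refine integral_congr_ae (Eventually.of_forall fun x => ?_)
    beta_reduce
    by_cases hx : x ∈ tsupport U
    · have hz : x₀ - x ≠ 0 := by
        intro h; have := hfar x hx; rw [h, norm_zero] at this; exact absurd this (not_lt.2 hr.le)
      rw [fderiv_fderiv_dipoleFar_eq hr (hfar x hx), fderiv3_newtonKernel_edd_eq_dde hz]
    · have hU0 : U x = 0 := image_eq_zero_of_notMem_tsupport hx
      simp [hU0]
  rw [step1, step2, step3]

/-- **THE STRICT ANCHOR TEST OF A SYMMETRIC COMPOSITE DESIGN WITH A POINTWISE-SIGNED INTEGRAND.**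
`U = U₁ + U₂`, `U₁, U₂ ∈ C_c^∞` divergence free with disjoint supports, `U₁` EVEN about `x₀`, and
`tsupport U₂` at distance `> r > 0` from `x₀`. Then the strict test at `x₀` holds iff
`−ν⟪U₁(x₀), ΔU₁(x₀)⟫ < ∫ D³Γ(x₀ − x)(U₂ x, U₂ x, U₁ x₀) dx`; the integrand is positive wherever
`U₂ x ⊥ U₁ x₀`, `⟪x₀ − x, U₁ x₀⟫ < 0` and `5⟨x₀ − x, U₂ x⟩² < ‖x₀ − x‖²‖U₂ x‖²`
(`fderiv3_newtonKernel_dde_pos`). [cite: MajdaBertozziCUP2002, §1.8 Prop. 1.16] -/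
theorem anchor_test_iff_fderiv3 {ν : ℝ} {U₁ U₂ : EuclideanSpace ℝ (Fin 3) → EuclideanSpace ℝ (Fin 3)}
    {x₀ : EuclideanSpace ℝ (Fin 3)} (h₁ : ContDiff ℝ ∞ U₁) (h₁c : HasCompactSupport U₁)
    (hdiv₁ : VectorCalculus.IsDivFree U₁) (he : IsEvenAbout x₀ U₁)
    (h₂ : ContDiff ℝ ∞ U₂) (h₂c : HasCompactSupport U₂) (hdiv₂ : VectorCalculus.IsDivFree U₂)
    (hd : Disjoint (tsupport U₁) (tsupport U₂)) {r : ℝ} (hr : 0 < r)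
    (hfar : ∀ x ∈ tsupport U₂, r < ‖x₀ - x‖) :
    0 < ⟪(U₁ + U₂) x₀, accel ν (U₁ + U₂) x₀⟫ ↔
      -(ν * ⟪U₁ x₀, (Δ U₁) x₀⟫) <
        ∫ x, fderiv ℝ (fun w => fderiv ℝ (fun w' => fderiv ℝ newtonKernel w' (U₂ x)) w (U₂ x))
          (x₀ - x) (U₁ x₀) := by
  have hx₀ : x₀ ∉ tsupport U₂ := fun h => by
    have := hfar x₀ h
    rw [sub_self, norm_zero] at this
    exact absurd this (not_lt.2 hr.le)
  rw [anchor_test_iff_of_even_add_far h₁ h₁c hdiv₁ he h₂ h₂c hd hx₀,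
    ← real_inner_comm (U₁ x₀) (gradient (pot ν U₂) x₀),
    inner_gradient_pot_eq_neg_integral_fderiv3 h₂ h₂c hdiv₂ hr hfar (U₁ x₀)]
  constructor <;> intro h <;> linarith

end Summit.NavierStokesRegularity.FluidComputer.PalasekTowerClayBridge.Germ

end
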